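import Literature.Topology.FourManifolds.BCSStablyParallelizable
import Literature.Topology.FourManifolds.HomotopySpheresSignatureConnectedSum
import HarnessLib

/-!
# Signatures add over connected sums of homotopy spheres bounding s-parallelizable manifolds

Discharge of the named fact
`Literature.Topology.FourManifolds.HomotopySphere.add_mem_signatureSet_of_isOrientedConnectedSum`
(`HomotopySpheresSignature.lean`): M. Kervaire, J. Milnor, *Groups of homotopy spheres I*,
Ann. of Math. 77 (1963), §2 pp. 506–508 — Lemma 2.2 and its Addendum: for `M₁ = bW₁`,
`M₂ = bW₂` the connected sum along the boundary `W = W₁ ♮ W₂` is bounded by `M₁ # M₂`, is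
s-parallelizable if `W₁`, `W₂` are, "and clearly has signature `σ(W) = σ(W₁) + σ(W₂)`" — as used
in the proof of Thm. 7.5 (p. 529) to make `σ` a homomorphism on `bP₄ₘ`.

The proof assembles: the construction of `W_U = W_S ♮ W_T` over the oriented connected sum
`U = S # T` (`BCSConstruction.lean`, `HomotopySphere.BCSModel`), its s-parallelizability
(`BCSStablyParallelizable.lean`), and the signature statement for the packaged sum
(`HomotopySpheresSignatureConnectedSum.lean`, `add_mem_signatureSet_of_bcsModel`: gluing of
relative fundamental classes, compatibility of the glued orientation with `U`, and additivity of
the signature over the two collapses `Ŵ_U → Ŵ_S`, `Ŵ_U → Ŵ_T`).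

* `HomotopySphere.exists_bcsModel_isStablyParallelizable` — the packaged boundary connected sum
  together with its s-parallelizability;
* `HomotopySphere.add_mem_signatureSet_of_isOrientedConnectedSum_holds` — the discharge.

## References

* M. A. Kervaire, J. W. Milnor, *Groups of homotopy spheres: I*, Ann. of Math. (2) 77 (1963),
  504–537, §2 (pp. 506–508, Lemma 2.2 and Addendum) and proof of Thm. 7.5 (p. 529).
  [KervaireMilnorAnnals1963]
-/

noncomputable section

open scoped Manifold ContDiff Topology
open Set Function Topology TopologicalSpace
open Literature.AlgebraicTopology.SingularHomology

namespace Literature.Topology.FourManifolds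

namespace HomotopySphere

variable {n : ℕ}

/-- **The boundary connected sum of two null-cobordisms of homotopy spheres, packaged, together
with its s-parallelizability** (Kervaire–Milnor 1963, §2 p. 508: `W₁ ♮ W₂` is bounded by
`M₁ # M₂` and is s-parallelizable if `W₁`, `W₂` are). The construction is that of
`HomotopySphere.nonempty_bcsModel`, kept together with the `BCSSetup` it comes from so that
`BCSSetup.isStablyParallelizable_glued` applies. [cite: KervaireMilnorAnnals1963, §2 p. 508] -/
theorem exists_bcsModel_isStablyParallelizable (S T U : HomotopySphere (n + 1))
    (h : IsOrientedConnectedSum S.orientation T.orientation U.orientation)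
    (cS : NullCobordism (n + 1) S.carrier) (cT : NullCobordism (n + 1) T.carrier) :
    ∃ B : BCSModel S T U cS cT,
      IsStablyParallelizable (𝓡∂ (n + 2)) cS.W → IsStablyParallelizable (𝓡∂ (n + 2)) cT.W →
        IsStablyParallelizable (𝓡∂ (n + 2)) B.cU.W := by
  obtain ⟨i₁, i₂, o₀, jA', jB', hi₁, hi₂, -, -, ⟨hjA', hjA'o, hjB', hjB'o, hcov', hrel'⟩, hopA, hopB⟩ := h
  -- charts of `S`, `T` inverting the discs
  obtain ⟨e₁, he₁, ht₁, hse₁⟩ := ConnectedSumData.exists_of_isSmoothEmbedding hi₁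
  obtain ⟨e₂, he₂, ht₂, hse₂⟩ := ConnectedSumData.exists_of_isSmoothEmbedding hi₂
  subst hse₁ hse₂
  let Dσ : ConnectedSumData (n + 1) S.carrier T.carrier := ⟨e₁, e₂, he₁, he₂, ht₁, ht₂⟩
  haveI : Nonempty S.carrier := S.nonempty_carrier
  haveI : Nonempty T.carrier := T.nonempty_carrier
  -- collars and collar half-discs
  obtain ⟨κS⟩ := BoundaryData.nonempty_collar_of_compactSpace n cS.W cS.boundaryData
  obtain ⟨κT⟩ := BoundaryData.nonempty_collar_of_compactSpace n cT.W cT.boundaryData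
  have hkS := κS.isSmoothEmbedding_halfDisc hi₁ (isOpen_range_of_isSmoothEmbedding_disc hi₁)
  have hkT := κT.isSmoothEmbedding_halfDisc hi₂ (isOpen_range_of_isSmoothEmbedding_disc hi₂)
  -- the gluing `W_S ♮ W_T`
  obtain ⟨P, _, _, _, _, _, hglue⟩ :=
    (HalfDiscPair.mk (κS.halfDisc ⇑e₁.symm) (κT.halfDisc ⇑e₂.symm) hkS.1 hkS.2 hkT.1 hkT.2).exists_isOpenGluing
  haveI : CompactSpace P := compactSpace_of_isOpenGluing_boundaryConnectedSumRel_holds (n + 2) cS.W cT.W P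
    _ _ hkS.1 hkS.2 hkT.1 hkT.2 hglue
  obtain ⟨W⟩ := HalfGluing.nonempty_of_isOpenGluing hglue
  -- `U ≅ S # T` compatibly with the gluing maps
  obtain ⟨Ψ, hΨA, hΨB⟩ := IsOpenGluing.exists_diffeomorph_comp_eq
    (IP := 𝓡 (n + 1)) (IP' := 𝓘(ℝ, EuclideanSpace ℝ (Fin (n + 1)))) (P := U.carrier)
    (P' := (Dσ.glueData (Nat.succ_ne_zero n)).Glued)
    hjA' hjA'o hjB' hjB'o hcov' hrel'
    (Dσ.glueData (Nat.succ_ne_zero n)).isSmoothEmbedding_inl (Dσ.glueData (Nat.succ_ne_zero n)).isOpen_range_inl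
    (Dσ.glueData (Nat.succ_ne_zero n)).isSmoothEmbedding_inr (Dσ.glueData (Nat.succ_ne_zero n)).isOpen_range_inr
    (Dσ.glueData (Nat.succ_ne_zero n)).range_inl_union_range_inr
    (fun a b => Dσ.inl_eq_inr_iff_connectedSumRel (Nat.succ_ne_zero n) a b)
  let X : NullCobordism.BCSSetup n :=
    { MS := S.carrier
      MT := T.carrier
      MU := U.carrier
      cS := cS
      cT := cT
      κS := κS
      κT := κT
      iS := ⇑e₁.symm
      iT := ⇑e₂.symm
      hiS := hi₁
      hiT := hi₂
      P := P
      W := W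
      Dσ := Dσ
      hD₁ := rfl
      hD₂ := rfl
      jA := jA'
      jB := jB'
      hjA := hjA'
      hjAo := hjA'o
      hjB := hjB'
      hjBo := hjB'o
      Ψ := Ψ
      hΨA := hΨA
      hΨB := hΨB }
  refine ⟨
    { κS := κS
      κT := κT
      cU := X.glued
      G := X.gluing
      LS := X.linkS
      LT := X.linkT
      hopS := hopA
      hopT := hopB
      nonempty_linkS := X.nonempty_linkS_A'
      nonempty_linkT := X.nonempty_linkT_A'
      containsS := X.containsS
      containsT := X.containsT
      collarS := X.collarS
      collarT := X.collarT
      contractible_overlap := X.contractibleSpace_overlap }, fun hS hT => ?_⟩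
  exact X.isStablyParallelizable_glued hS hT


/-- **Discharge of `HomotopySphere.add_mem_signatureSet_of_isOrientedConnectedSum`**
(Kervaire–Milnor 1963, §2 pp. 506–508 with the proof of Thm. 7.5, p. 529): for an oriented
connected sum `U = S # T` of homotopy `(4m-1)`-spheres and signatures `σ ∈ signatureSet S`,
`τ ∈ signatureSet T` (signatures of oriented s-parallelizable null-cobordisms, read on the closed
models), `σ + τ ∈ signatureSet U` — witnessed by the boundary connected sum of the two
null-cobordisms. [cite: KervaireMilnorAnnals1963, §2 pp. 506–508 and proof of Thm. 7.5 (p. 529)] -/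
theorem add_mem_signatureSet_of_isOrientedConnectedSum_holds :
    add_mem_signatureSet_of_isOrientedConnectedSum := by
  intro n m h g S T U hcs σ hσ τ hτ
  obtain ⟨mm, rfl⟩ : ∃ mm, n = mm + 1 := ⟨n - 1, by omega⟩
  obtain ⟨μS, cS, μ'S, hμS, hspS, hobS, rfl⟩ := hσ
  obtain ⟨μT, cT, μ'T, hμT, hspT, hobT, rfl⟩ := hτ
  obtain ⟨B, hsp⟩ := exists_bcsModel_isStablyParallelizable S T U hcs cS cT
  exact add_mem_signatureSet_of_bcsModel h g S T U B (hsp hspS hspT) hμS hμT hobS hobT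

end HomotopySphere

end Literature.Topology.FourManifolds
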